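import Summits.QuantumFields.BalabanUV.Beta.EriceRemainderEnclosureHistoryAutonomyComparisonAgeCompositionEnteringLag
import Summits.QuantumFields.BalabanUV.Beta.EriceRemainderEnclosureHistoryAutonomyComparisonAgeCompositionDecayRoute

/-!
# EriceRemainderEnclosureHistoryAutonomyComparisonAgeCompositionEnteringLagLevels — (E86c) route (N), first order: THE ENTERING-LAG IDENTITY AT EVERY
# LEVEL — MONO″ of a multi-lag age BELOW A GROWING INPUT from the static family (S-e), and the reads by an OLDER age of the drops of a multi-lag YOUNGER age
# non-increasing from the static family (S-h) («decay + defect») — the two k-uniform replacements for (S-b)ᵢ and (S-a)ₖ that three and more loaded ages need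

Cell `pub-balaban`, β-function sub-cell, BINDER row D4 «RemainderConst leaves for Bałaban's split» (`HOME/BINDER-OWNERS.md`; owner lineage `b2b-balaban-beta-an4`;
this file by co-owner #2 lineage `b2b-balaban-beta-d4-p2`, generation 77), β-FLOW TEAM duty (1), FREEZE (0) honoured (def-free; imports (E83a) `…EnteringLag`
and (E83i) `…DecayRoute`; uses (E83a) `read_succ_onelag`, (E83i) `growth_chain`, (E71a) `read_le_read` ∕ `read_nonneg` ∕ `sol_nonneg_le_of_supersol` BY NAME;
nothing restated).  First file of successor item «what replaces (S-b)_{k₂} and (S-a)_{k₃} for three loaded ages» of README `HOME/b2b-balaban-beta-d4-p2/g77/e86/README.md` §4.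

HONEST FRAMING (page 1, verbatim and binding).  *"Discharging BetaPertH makes Bałaban's UV stability UNCONDITIONAL — a real constructive-QFT result; it is
NOT the continuum limit and NOT the Clay problem."*  THIS FILE DISCHARGES NOTHING OF THE KIND.  Elementary real algebra about ABSTRACT triangular renewal
systems — hypotheses of a census, not facts; the age profile of Bałaban's (1.22) limit functional is NOT PRINTED ([I] p. 298; GAPS G-t4-U2-1∕-2) and NOT
asserted.  Row D4 class UNCHANGED (critical-path width 0; instance 0∕1; D4 DISCHARGE NO DATE).  HONEST DEPENDENCY: continuum YM on T⁴ ⇐ BetaPertH ∧ nine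
spine estimates (0/9 proved); BetaPertH ⇐ (D1) ∧ (D4) ∧ CAP+tail; G-an2-4 gates asym, D1 and NE2/3/4.

THE POINT (census sense (α); route (N); README `HOME/b2b-balaban-beta-d4-p2/g77/e86/README.md` §§3–4).  (E83j)'s joint induction asks, at a level `i` whose
age has SEVERAL lags, the tail-sum family (S-b)ᵢ (for MONO″ᵢ through read decay by the factor `1 + Mᵢ`) and, for every older age `k`, the row-mass family
(S-a)ₖ (for (MONO) of the pair `(i,k)`; the decay route (E83i) serves one-lag `i` only).  The generation-77 census (`g77/numerics/t3job`, kit j333924: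
three loaded ages `{1,k₂,k₃}`, `k₃ ≤ 128`, benign affine flows) found (S-b)_{k₂} FALSE already in the UNDAMPED class when the middle age is long and
loaded (`x_{k₂} ≳ 1∕2`; ratio `+2·10⁻⁴`, `+2.5·10⁻³` under the adversarial relaxed pattern) and (S-a)_{k₃}, (S-c♯) with margins `≈ 0.4∕k₃` — while the
EXACT properties MONO″_{k₂}, (MONO)_{(k₂,k₃)}, (M1) hold everywhere.  The slack is in the surrogates, and (E83a)'s ENTERING-LAG IDENTITY `read_succ_onelag`
— valid for EVERY input, not only truncations — removes it at every level: for a lone kernel `K` with the flow's one-lag structure `K (m+1) l = σ_m·K m (l+1)`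
and ANY `t`, `R t (m+1) = σ_m(R t m − K m 0·t(m+1)) + K (m+1)(y−1)·t(m+1+y)`, so `R t (m+1) ≤ R t m` as soon as the ENTERING term is at most
`(1−σ_m)·R t m + σ_m·K m 0·t(m+1)`; the edge regime (`t(m+1+y) = 0`) is free.  §1 **`mono2_of_entering`**: `t` the young solution below an older surplus
`v ≥ 0` supported on `[0,j]`, non-decreasing below the edge ((M1) of the levels above), with per-pin growth `v(p+1) ≤ H_p·v(p)` and KEY ratio `R v ≤ ρ·v`
(`ρ ≤ 1`): MONO″ (the young drops `R t` non-increasing in the pin) ⟸ the static family **(S-e)**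
`K (m+1)(y−1)·Π_{p∈[m+1,m+1+y)} H_p ≤ (1−σ_m)·Σ_{l<y} K m l·(1−ρ(m+1+l)) + σ_m·K m 0·(1−ρ(m+1))` at the pins `m+1+y ≤ j` — «entering entry × growth over
the window ≤ defect × row mass × (1 − KEY ratio) + σ × leaving entry × (1 − KEY ratio)».  §2 **`old_read_antitone_of_decay_defect`**: `Ko` an OLDER one-lag-
structured kernel reading the young drops `d = Ry t`: `Ro d (n+1) ≤ Ro d n` ⟸ the static family **(S-h)** (displayed in the theorem; «entering entry of the
old age × young row mass one old window deeper × growth ≤ old defect × Σ_{l'} old entries × young lower masses + σ × old leaving entry × young lower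
mass», the young lower masses `A p = Σ_{l<y, p+1+l ≤ j} Ky p l·(1−ρ(p+1+l))` carrying the edge `j` exactly as (E83j)'s `HgS`); for a ONE-lag young age
(S-h) is (E83i)'s (S-d) with the old defect's credit added.  NUMERICS OF RECORD (`g77/numerics/t3job`, README §3): on every benchmark three-age flow
(8 load regimes, `k₃ ≤ 128`, classes one∕self∕lower∕adversarial-relaxed) log-ratios (S-e)_{k₂} `−0.03 … −0.62` where (S-b)_{k₂} is `−0.0002 … +0.0025`,
(S-h)_{(k₂,k₃)} `−0.61 … −1.94` where (S-a)_{k₃} is `−0.008 … −0.13` and (E83i)'s decay-only criterion reaches `+0.18`; the intermediate edge positions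
are never worse than the deep regime.  NOT CLAIMED: (S-e)∕(S-h) along flows; the re-cut of (E83j)'s induction that consumes them (successor); anything
nonlinear; anything printed — NOT B12 Thm 2, NOT BetaPertH.

WHAT IS PROVED ([folklore]; 0 `def`, 0 sorry).  §0 `mono_chain`, `sol_support`, `sol_lower`; §1 **`mono2_of_entering`**; §2 **`old_read_antitone_of_decay_defect`**.
v1.1 (same generation) APPENDS §3 **`mono2_of_entering_backward`** — the family (S-e″): the window read against its DEEP end through the growth chain read
backwards; no monotonicity of the input; never weaker than (S-e) for `H ≥ 1`; negative on every benchmark flow where (S-e) fails — and modifies NO existing declaration.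
-/
noncomputable section
open Finset

namespace Summit.QuantumFields.BalabanUV.Beta.EriceRemainderEnclosureHistoryAutonomyComparisonAgeCompositionEnteringLagLevels

open Summit.QuantumFields.BalabanUV.Beta.EriceRemainderEnclosureHistoryAutonomyComparisonAgeComposition
open Summit.QuantumFields.BalabanUV.Beta.EriceRemainderEnclosureHistoryAutonomyComparisonAgeCompositionEnteringLag (read_succ_onelag)
open Summit.QuantumFields.BalabanUV.Beta.EriceRemainderEnclosureHistoryAutonomyComparisonAgeCompositionDecayRoute (growth_chain)

variable {N y : ℕ} {K : ℕ → ℕ → ℝ} {R : (ℕ → ℝ) → ℕ → ℝ} {σ : ℕ → ℝ}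

/-! ## §0 Bookkeeping: monotone chains below the edge, support and lower bound of the young solution -/

/-- A sequence non-decreasing below the edge `j` grows along every chain that stays below the edge. [folklore] -/
theorem mono_chain {v : ℕ → ℝ} {j : ℕ} (hmono : ∀ m, m < j → v m ≤ v (m + 1)) : ∀ q a, a + q ≤ j → v a ≤ v (a + q) := by
  intro q
  induction q with
  | zero => intro a _; simp
  | succ q ih => intro a hq; exact (ih a (by omega)).trans (by rw [← add_assoc]; exact hmono (a + q) (by omega))

/-- The young solution `t` (`0 ≤ t ≤ v`) vanishes beyond the support of its input. [folklore] -/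
theorem sol_support {v t : ℕ → ℝ} {j : ℕ} (hvj : ∀ n, j < n → v n = 0) (htv : ∀ n, 0 ≤ t n ∧ t n ≤ v n) : ∀ n, j < n → t n = 0 :=
  fun n hn => le_antisymm ((htv n).2.trans (hvj n hn).le) (htv n).1

/-- THE YOUNG SOLUTION FROM BELOW BY THE KEY RATIO: `t = v − R t ≥ v − R v ≥ (1 − ρ)·v`. [folklore] -/
theorem sol_lower (hR : ∀ v n, R v n = ∑ l ∈ range N, K n l * v (n + 1 + l)) (hK : ∀ n l, 0 ≤ K n l)
    {v t ρ : ℕ → ℝ} (hkey : ∀ n, R v n ≤ ρ n * v n) (htv : ∀ n, 0 ≤ t n ∧ t n ≤ v n) (hrec : ∀ n, t n = v n - R t n) (n : ℕ) :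
    (1 - ρ n) * v n ≤ t n := by
  have h := read_le_read hR hK (t := t) (v := v) (n := n) fun m _ => (htv m).2
  rw [hrec n]; linarith [hkey n]

/-! ## §1 MONO″ of a multi-lag age below a growing input, from the entering-lag identity: the static family (S-e) -/

/-- **MONO″ AT EVERY LEVEL FROM THE ENTERING-LAG IDENTITY.**  Non-negative window kernel `K` (`y ≥ 1` lags, horizon `N`) with the one-lag structure
`K (m+1) l = σ_m·K m (l+1)` (`l+1 < y`), `0 ≤ σ ≤ 1`.  Input `v ≥ 0` supported on `[0,j]` (`j ≤ N`), NON-DECREASING below the edge, with per-pin growth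
`v(p+1) ≤ H_p·v(p)` (`H ≥ 0`) and KEY ratio `R v ≤ ρ·v` (`ρ ≤ 1`); `t` the zero-tailed solution of `t = v − R t`.  IF the static family (S-e) holds at the
pins `m` with `m+1+y ≤ j`:  `K (m+1)(y−1)·Π_{p∈[m+1,m+1+y)} H_p ≤ (1−σ_m)·Σ_{l<y} K m l·(1−ρ(m+1+l)) + σ_m·K m 0·(1−ρ(m+1))`, THEN the young drops are
non-increasing in the pin: `R t (m+1) ≤ R t m` for every `m` (the pins with `j < m+1+y` are free). [folklore] -/
theorem mono2_of_entering (hR : ∀ v n, R v n = ∑ l ∈ range N, K n l * v (n + 1 + l)) (hK : ∀ n l, 0 ≤ K n l)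
    (hKy : ∀ n l, y ≤ l → K n l = 0) (hy : 1 ≤ y) (hyN : y ≤ N)
    (hσ : ∀ n l, l + 1 < y → K (n + 1) l = σ n * K n (l + 1)) (hσ01 : ∀ n, 0 ≤ σ n ∧ σ n ≤ 1)
    {v : ℕ → ℝ} {j : ℕ} (hv0 : ∀ n, 0 ≤ v n) (hvj : ∀ n, j < n → v n = 0) (hmono : ∀ m, m < j → v m ≤ v (m + 1))
    {H : ℕ → ℝ} (hH0 : ∀ p, 0 ≤ H p) (hgrow : ∀ p, v (p + 1) ≤ H p * v p)
    {ρ : ℕ → ℝ} (hkey : ∀ n, R v n ≤ ρ n * v n) (hρ1 : ∀ n, ρ n ≤ 1)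
    {t : ℕ → ℝ} (htail : ∀ n, N < n → t n = 0) (hrec : ∀ n, t n = v n - R t n)
    (hSe : ∀ m, m + 1 + y ≤ j → K (m + 1) (y - 1) * ∏ p ∈ Ico (m + 1) (m + 1 + y), H p ≤
      (1 - σ m) * ∑ l ∈ range y, K m l * (1 - ρ (m + 1 + l)) + σ m * (K m 0 * (1 - ρ (m + 1)))) :
    ∀ m, R t (m + 1) ≤ R t m := by
  have hsup : ∀ n, R v n ≤ v n := fun n => (hkey n).trans (by nlinarith [hρ1 n, hv0 n])
  have htv := sol_nonneg_le_of_supersol hR hK hv0 hsup htail hrec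
  have ht0 := sol_support hvj htv
  have htlow := sol_lower hR hK hkey htv hrec
  intro m
  have hid := read_succ_onelag hR hKy hy hyN hσ t m
  -- the leaving term is part of the read
  have hlead : K m 0 * t (m + 1) ≤ R t m := by
    rw [hR]
    have h := single_le_sum (f := fun l => K m l * t (m + 1 + l)) (fun l _ => mul_nonneg (hK m l) (htv _).1) (mem_range.mpr (by omega : 0 < N))
    simpa using h
  -- the criterion form of the identity
  have hcrit : K (m + 1) (y - 1) * t (m + 1 + y) ≤ (1 - σ m) * R t m + σ m * (K m 0 * t (m + 1)) → R t (m + 1) ≤ R t m := by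
    intro h
    have e1 : σ m * (R t m - K m 0 * t (m + 1)) = σ m * R t m - σ m * (K m 0 * t (m + 1)) := by ring
    have e2 : (1 - σ m) * R t m = R t m - σ m * R t m := by ring
    rw [hid]; linarith
  by_cases hedge : j < m + 1 + y
  · -- THE EDGE REGIME IS FREE: the entering lag reads beyond the edge
    refine hcrit ?_
    rw [ht0 _ hedge, mul_zero]
    have h1 : 0 ≤ (1 - σ m) * R t m := mul_nonneg (by linarith [(hσ01 m).2]) (by linarith [mul_nonneg (hK m 0) (htv (m + 1)).1])
    have h2 : 0 ≤ σ m * (K m 0 * t (m + 1)) := mul_nonneg (hσ01 m).1 (mul_nonneg (hK m 0) (htv _).1)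
    linarith
  · -- THE DEEP PINS: the static family (S-e) with the two-sided control of the input
    have hmj : m + 1 + y ≤ j := by omega
    refine hcrit ?_
    -- upper: the entering lag reads the young solution one window deeper, below the input grown over the window
    have hup : t (m + 1 + y) ≤ (∏ p ∈ Ico (m + 1) (m + 1 + y), H p) * v (m + 1) := (htv _).2.trans (growth_chain hH0 hgrow (m + 1) y)
    -- lower: the read of the young solution against the input at the top of the window
    have hlow : (∑ l ∈ range y, K m l * (1 - ρ (m + 1 + l))) * v (m + 1) ≤ R t m := by
      rw [hR, sum_mul]
      have hsub : ∑ l ∈ range y, K m l * t (m + 1 + l) ≤ ∑ l ∈ range N, K m l * t (m + 1 + l) :=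
        sum_le_sum_of_subset_of_nonneg (range_subset_range.mpr hyN) fun l _ _ => mul_nonneg (hK m l) (htv _).1
      refine le_trans (sum_le_sum fun l hl => ?_) hsub
      have hly := mem_range.mp hl
      have hv1 : v (m + 1) ≤ v (m + 1 + l) := mono_chain hmono l (m + 1) (by omega)
      have hρl : 0 ≤ 1 - ρ (m + 1 + l) := by linarith [hρ1 (m + 1 + l)]
      calc K m l * (1 - ρ (m + 1 + l)) * v (m + 1) ≤ K m l * ((1 - ρ (m + 1 + l)) * v (m + 1 + l)) := by
            rw [mul_assoc]; exact mul_le_mul_of_nonneg_left (mul_le_mul_of_nonneg_left hv1 hρl) (hK m l)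
        _ ≤ K m l * t (m + 1 + l) := mul_le_mul_of_nonneg_left (htlow _) (hK m l)
    have hlow0 : K m 0 * ((1 - ρ (m + 1)) * v (m + 1)) ≤ K m 0 * t (m + 1) := mul_le_mul_of_nonneg_left (htlow _) (hK m 0)
    -- combine
    have h1 : K (m + 1) (y - 1) * t (m + 1 + y) ≤ K (m + 1) (y - 1) * ((∏ p ∈ Ico (m + 1) (m + 1 + y), H p) * v (m + 1)) :=
      mul_le_mul_of_nonneg_left hup (hK _ _)
    have h2 : (1 - σ m) * ((∑ l ∈ range y, K m l * (1 - ρ (m + 1 + l))) * v (m + 1)) ≤ (1 - σ m) * R t m :=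
      mul_le_mul_of_nonneg_left hlow (by linarith [(hσ01 m).2])
    have h3 : σ m * (K m 0 * ((1 - ρ (m + 1)) * v (m + 1))) ≤ σ m * (K m 0 * t (m + 1)) := mul_le_mul_of_nonneg_left hlow0 (hσ01 m).1
    have h4 : (K (m + 1) (y - 1) * ∏ p ∈ Ico (m + 1) (m + 1 + y), H p) * v (m + 1) ≤
        ((1 - σ m) * ∑ l ∈ range y, K m l * (1 - ρ (m + 1 + l)) + σ m * (K m 0 * (1 - ρ (m + 1)))) * v (m + 1) :=
      mul_le_mul_of_nonneg_right (hSe m hmj) (hv0 _)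
    have e1 : K (m + 1) (y - 1) * ((∏ p ∈ Ico (m + 1) (m + 1 + y), H p) * v (m + 1)) =
        (K (m + 1) (y - 1) * ∏ p ∈ Ico (m + 1) (m + 1 + y), H p) * v (m + 1) := by ring
    have e2 : ((1 - σ m) * ∑ l ∈ range y, K m l * (1 - ρ (m + 1 + l)) + σ m * (K m 0 * (1 - ρ (m + 1)))) * v (m + 1) =
        (1 - σ m) * ((∑ l ∈ range y, K m l * (1 - ρ (m + 1 + l))) * v (m + 1)) + σ m * (K m 0 * ((1 - ρ (m + 1)) * v (m + 1))) := by ring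
    linarith

/-! ## §2 Older reads of the drops of a multi-lag younger age: the static family (S-h) («decay + defect») -/

/-- **(MONO) FOR A PAIR OF MULTI-LAG AGES FROM DECAY AND DEFECT.**  Young side as in `mono2_of_entering` (kernel `Ky`, `y ≥ 1` lags, input `v` supported
on `[0,j]`, non-decreasing below the edge, growth `H ≥ 0`, KEY ratio `ρ ≤ 1`, young solution `t`, young drops `d = Ry t`).  Old side: a non-negative
window kernel `Ko` (`yo ≥ 1` lags) with the one-lag structure `Ko (n+1) l = σo_n·Ko n (l+1)`, `0 ≤ σo ≤ 1`, reads `Ro`.  Young LOWER MASSES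
`A p = Σ_{l<y} [p+1+l ≤ j]·Ky p l·(1−ρ(p+1+l))` (`d(p) ≥ A p·v(p+1)`).  IF the static family **(S-h)** holds at the pins `n` with `n+1+yo ≤ j`:
`Ko (n+1)(yo−1)·Σ_{l<y} Ky (n+1+yo) l·Π_{s∈[n+2, n+2+yo+l)} H_s ≤ (1−σo_n)·Σ_{l'<yo} Ko n l'·A(n+1+l') + σo_n·Ko n 0·A(n+1)`, THEN the old reads of
the young drops are non-increasing in the pin: `Ro (Ry t) (n+1) ≤ Ro (Ry t) n` for every `n` (the pins with `j < n+1+yo` are free: the young drops vanish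
beyond the edge).  For `y = 1` this is (E83i)'s decay route with the old defect's credit `(1−σo)·(…)` added. [folklore] -/
theorem old_read_antitone_of_decay_defect
    {Ky : ℕ → ℕ → ℝ} {Ry : (ℕ → ℝ) → ℕ → ℝ}
    (hRy : ∀ v n, Ry v n = ∑ l ∈ range N, Ky n l * v (n + 1 + l)) (hKy : ∀ n l, 0 ≤ Ky n l) (hKyy : ∀ n l, y ≤ l → Ky n l = 0) (hyN : y ≤ N)
    {yo : ℕ} {Ko : ℕ → ℕ → ℝ} {Ro : (ℕ → ℝ) → ℕ → ℝ} {σo : ℕ → ℝ}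
    (hRo : ∀ v n, Ro v n = ∑ l ∈ range N, Ko n l * v (n + 1 + l)) (hKo : ∀ n l, 0 ≤ Ko n l) (hKoy : ∀ n l, yo ≤ l → Ko n l = 0)
    (hyo : 1 ≤ yo) (hyoN : yo ≤ N)
    (hσo : ∀ n l, l + 1 < yo → Ko (n + 1) l = σo n * Ko n (l + 1)) (hσo01 : ∀ n, 0 ≤ σo n ∧ σo n ≤ 1)
    {v : ℕ → ℝ} {j : ℕ} (hv0 : ∀ n, 0 ≤ v n) (hvj : ∀ n, j < n → v n = 0) (hmono : ∀ m, m < j → v m ≤ v (m + 1))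
    {H : ℕ → ℝ} (hH0 : ∀ p, 0 ≤ H p) (hgrow : ∀ p, v (p + 1) ≤ H p * v p)
    {ρ : ℕ → ℝ} (hkey : ∀ n, Ry v n ≤ ρ n * v n) (hρ1 : ∀ n, ρ n ≤ 1)
    {t : ℕ → ℝ} (htail : ∀ n, N < n → t n = 0) (hrec : ∀ n, t n = v n - Ry t n)
    {A : ℕ → ℝ} (hA : ∀ p, A p = ∑ l ∈ range y, if p + 1 + l ≤ j then Ky p l * (1 - ρ (p + 1 + l)) else 0)
    (hSh : ∀ n, n + 1 + yo ≤ j →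
      Ko (n + 1) (yo - 1) * ∑ l ∈ range y, Ky (n + 1 + yo) l * ∏ s ∈ Ico (n + 2) (n + 2 + yo + l), H s ≤
        (1 - σo n) * ∑ l' ∈ range yo, Ko n l' * A (n + 1 + l') + σo n * (Ko n 0 * A (n + 1))) :
    ∀ n, Ro (Ry t) (n + 1) ≤ Ro (Ry t) n := by
  have hsup : ∀ n, Ry v n ≤ v n := fun n => (hkey n).trans (by nlinarith [hρ1 n, hv0 n])
  have htv := sol_nonneg_le_of_supersol hRy hKy hv0 hsup htail hrec
  have ht0 := sol_support hvj htv
  have htlow := sol_lower hRy hKy hkey htv hrec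
  -- the young drops: signs, support, the static sandwich
  set d : ℕ → ℝ := Ry t with hd
  have hd0 : ∀ p, 0 ≤ d p := fun p => read_nonneg hRy hKy fun m _ => (htv m).1
  have hdz : ∀ p, j < p + 1 → d p = 0 := fun p hp => by
    rw [hd, hRy]; exact sum_eq_zero fun l _ => by rw [ht0 _ (by omega), mul_zero]
  have hA0 : ∀ p, 0 ≤ A p := fun p => by
    rw [hA]; exact sum_nonneg fun l _ => by split_ifs <;> nlinarith [hKy p l, hρ1 (p + 1 + l)]
  have hdlow : ∀ p, A p * v (p + 1) ≤ d p := by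
    intro p
    rw [hA, hd, hRy, sum_mul]
    have hsub : ∑ l ∈ range y, Ky p l * t (p + 1 + l) ≤ ∑ l ∈ range N, Ky p l * t (p + 1 + l) :=
      sum_le_sum_of_subset_of_nonneg (range_subset_range.mpr hyN) fun l _ _ => mul_nonneg (hKy p l) (htv _).1
    refine le_trans (sum_le_sum fun l hl => ?_) hsub
    split_ifs with hpl
    · have hv1 : v (p + 1) ≤ v (p + 1 + l) := mono_chain hmono l (p + 1) (by omega)
      have hρl : 0 ≤ 1 - ρ (p + 1 + l) := by linarith [hρ1 (p + 1 + l)]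
      calc Ky p l * (1 - ρ (p + 1 + l)) * v (p + 1) ≤ Ky p l * ((1 - ρ (p + 1 + l)) * v (p + 1 + l)) := by
            rw [mul_assoc]; exact mul_le_mul_of_nonneg_left (mul_le_mul_of_nonneg_left hv1 hρl) (hKy p l)
        _ ≤ Ky p l * t (p + 1 + l) := mul_le_mul_of_nonneg_left (htlow _) (hKy p l)
    · rw [zero_mul]; exact mul_nonneg (hKy p l) (htv _).1
  have hdup : ∀ n, d (n + 1 + yo) ≤ (∑ l ∈ range y, Ky (n + 1 + yo) l * ∏ s ∈ Ico (n + 2) (n + 2 + yo + l), H s) * v (n + 2) := by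
    intro n
    rw [hd, hRy, sum_mul]
    have heq : ∑ l ∈ range N, Ky (n + 1 + yo) l * t (n + 1 + yo + 1 + l) = ∑ l ∈ range y, Ky (n + 1 + yo) l * t (n + 1 + yo + 1 + l) :=
      (sum_subset (range_subset_range.mpr hyN) fun l _ hly => by
        rw [hKyy _ l (by rw [mem_range, not_lt] at hly; exact hly), zero_mul]).symm
    rw [heq]
    refine sum_le_sum fun l _ => ?_
    have hg := growth_chain hH0 hgrow (n + 2) (yo + l)
    rw [show n + 2 + (yo + l) = n + 1 + yo + 1 + l by ring] at hg
    have hI : Ico (n + 2) (n + 1 + yo + 1 + l) = Ico (n + 2) (n + 2 + yo + l) := by rw [show n + 1 + yo + 1 + l = n + 2 + yo + l by ring]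
    rw [hI] at hg
    calc Ky (n + 1 + yo) l * t (n + 1 + yo + 1 + l) ≤ Ky (n + 1 + yo) l * v (n + 1 + yo + 1 + l) := mul_le_mul_of_nonneg_left (htv _).2 (hKy _ _)
      _ ≤ Ky (n + 1 + yo) l * ((∏ s ∈ Ico (n + 2) (n + 2 + yo + l), H s) * v (n + 2)) := mul_le_mul_of_nonneg_left hg (hKy _ _)
      _ = Ky (n + 1 + yo) l * (∏ s ∈ Ico (n + 2) (n + 2 + yo + l), H s) * v (n + 2) := by ring
  -- the old kernel reading the young drops: identity, leaving term, criterion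
  intro n
  have hid := read_succ_onelag hRo hKoy hyo hyoN hσo d n
  have hlead : Ko n 0 * d (n + 1) ≤ Ro d n := by
    rw [hRo]
    have h := single_le_sum (f := fun l => Ko n l * d (n + 1 + l)) (fun l _ => mul_nonneg (hKo n l) (hd0 _)) (mem_range.mpr (by omega : 0 < N))
    simpa using h
  have hcrit : Ko (n + 1) (yo - 1) * d (n + 1 + yo) ≤ (1 - σo n) * Ro d n + σo n * (Ko n 0 * d (n + 1)) → Ro d (n + 1) ≤ Ro d n := by
    intro h
    have e1 : σo n * (Ro d n - Ko n 0 * d (n + 1)) = σo n * Ro d n - σo n * (Ko n 0 * d (n + 1)) := by ring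
    have e2 : (1 - σo n) * Ro d n = Ro d n - σo n * Ro d n := by ring
    rw [hid]; linarith
  by_cases hedge : j < n + 1 + yo
  · -- free: the young drops vanish beyond the edge
    refine hcrit ?_
    rw [hdz _ (by omega), mul_zero]
    have h1 : 0 ≤ (1 - σo n) * Ro d n := mul_nonneg (by linarith [(hσo01 n).2]) (by linarith [mul_nonneg (hKo n 0) (hd0 (n + 1))])
    have h2 : 0 ≤ σo n * (Ko n 0 * d (n + 1)) := mul_nonneg (hσo01 n).1 (mul_nonneg (hKo n 0) (hd0 _))
    linarith
  · have hnj : n + 1 + yo ≤ j := by omega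
    refine hcrit ?_
    -- lower: every old lag reads a young drop at least `A · v`, and `v` there is at least `v (n+2)` (below the edge)
    have hlow : (∑ l' ∈ range yo, Ko n l' * A (n + 1 + l')) * v (n + 2) ≤ Ro d n := by
      rw [hRo, sum_mul]
      have hsub : ∑ l ∈ range yo, Ko n l * d (n + 1 + l) ≤ ∑ l ∈ range N, Ko n l * d (n + 1 + l) :=
        sum_le_sum_of_subset_of_nonneg (range_subset_range.mpr hyoN) fun l _ _ => mul_nonneg (hKo n l) (hd0 _)
      refine le_trans (sum_le_sum fun l hl => ?_) hsub
      have hly := mem_range.mp hl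
      have hv2 : v (n + 2) ≤ v (n + 1 + l + 1) := by
        have h := mono_chain hmono l (n + 2) (by omega); rwa [show n + 2 + l = n + 1 + l + 1 by ring] at h
      calc Ko n l * A (n + 1 + l) * v (n + 2) ≤ Ko n l * (A (n + 1 + l) * v (n + 1 + l + 1)) := by
            rw [mul_assoc]; exact mul_le_mul_of_nonneg_left (mul_le_mul_of_nonneg_left hv2 (hA0 _)) (hKo n l)
        _ ≤ Ko n l * d (n + 1 + l) := mul_le_mul_of_nonneg_left (hdlow _) (hKo n l)
    have hlow0 : Ko n 0 * (A (n + 1) * v (n + 2)) ≤ Ko n 0 * d (n + 1) := by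
      have h := hdlow (n + 1); rw [show n + 1 + 1 = n + 2 by ring] at h
      exact mul_le_mul_of_nonneg_left h (hKo n 0)
    have h1 : Ko (n + 1) (yo - 1) * d (n + 1 + yo) ≤
        Ko (n + 1) (yo - 1) * ((∑ l ∈ range y, Ky (n + 1 + yo) l * ∏ s ∈ Ico (n + 2) (n + 2 + yo + l), H s) * v (n + 2)) :=
      mul_le_mul_of_nonneg_left (hdup n) (hKo _ _)
    have h2 : (1 - σo n) * ((∑ l' ∈ range yo, Ko n l' * A (n + 1 + l')) * v (n + 2)) ≤ (1 - σo n) * Ro d n :=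
      mul_le_mul_of_nonneg_left hlow (by linarith [(hσo01 n).2])
    have h3 : σo n * (Ko n 0 * (A (n + 1) * v (n + 2))) ≤ σo n * (Ko n 0 * d (n + 1)) := mul_le_mul_of_nonneg_left hlow0 (hσo01 n).1
    have h4 : (Ko (n + 1) (yo - 1) * ∑ l ∈ range y, Ky (n + 1 + yo) l * ∏ s ∈ Ico (n + 2) (n + 2 + yo + l), H s) * v (n + 2) ≤
        ((1 - σo n) * ∑ l' ∈ range yo, Ko n l' * A (n + 1 + l') + σo n * (Ko n 0 * A (n + 1))) * v (n + 2) :=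
      mul_le_mul_of_nonneg_right (hSh n hnj) (hv0 _)
    have e1 : Ko (n + 1) (yo - 1) * ((∑ l ∈ range y, Ky (n + 1 + yo) l * ∏ s ∈ Ico (n + 2) (n + 2 + yo + l), H s) * v (n + 2)) =
        (Ko (n + 1) (yo - 1) * ∑ l ∈ range y, Ky (n + 1 + yo) l * ∏ s ∈ Ico (n + 2) (n + 2 + yo + l), H s) * v (n + 2) := by ring
    have e2 : ((1 - σo n) * ∑ l' ∈ range yo, Ko n l' * A (n + 1 + l') + σo n * (Ko n 0 * A (n + 1))) * v (n + 2) =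
        (1 - σo n) * ((∑ l' ∈ range yo, Ko n l' * A (n + 1 + l')) * v (n + 2)) + σo n * (Ko n 0 * (A (n + 1) * v (n + 2))) := by ring
    linarith

/-! ## §3 (APPEND, same generation) MONO″ from the entering-lag identity with the growth chain read BACKWARDS: the static family (S-e″) — no
monotonicity of the input, and never weaker than (S-e) -/

/-- **MONO″ AT EVERY LEVEL, (S-e″): THE WINDOW READ AGAINST ITS DEEP END.**  Setting of `mono2_of_entering`, but the input `v ≥ 0` (supported on `[0,j]`,
growth `v(p+1) ≤ H_p·v(p)` with `H > 0`, KEY ratio `ρ ≤ 1`) need NOT be monotone: every value inside the window is bounded BELOW by the value at the deep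
end through the growth chain (`v(m+1+l) ≥ v(m+1+y) ∕ Π_{p∈[m+1+l,m+1+y)} H_p`), and the entering lag reads at most `v(m+1+y)`.  IF the static family
**(S-e″)** holds at the pins `m+1+y ≤ j`:
`K (m+1)(y−1) ≤ (1−σ_m)·Σ_{l<y} K m l·(1−ρ(m+1+l)) ∕ Π_{p∈[m+1+l,m+1+y)} H_p + σ_m·K m 0·(1−ρ(m+1)) ∕ Π_{p∈[m+1,m+1+y)} H_p`,
THEN `R t (m+1) ≤ R t m` at every pin.  With `H ≥ 1` (S-e) implies (S-e″) (each partial product is at most the full one); the generation-77 census has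
(S-e″) negative on every benchmark three-age flow (log-ratio `−0.055 … −0.25`, `k₃ ≤ 128`) where (S-e) fails for a long silent middle age next to a
saturated old one (`+0.22`). [folklore] -/
theorem mono2_of_entering_backward (hR : ∀ v n, R v n = ∑ l ∈ range N, K n l * v (n + 1 + l)) (hK : ∀ n l, 0 ≤ K n l)
    (hKy : ∀ n l, y ≤ l → K n l = 0) (hy : 1 ≤ y) (hyN : y ≤ N)
    (hσ : ∀ n l, l + 1 < y → K (n + 1) l = σ n * K n (l + 1)) (hσ01 : ∀ n, 0 ≤ σ n ∧ σ n ≤ 1)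
    {v : ℕ → ℝ} {j : ℕ} (hv0 : ∀ n, 0 ≤ v n) (hvj : ∀ n, j < n → v n = 0)
    {H : ℕ → ℝ} (hH : ∀ p, 0 < H p) (hgrow : ∀ p, v (p + 1) ≤ H p * v p)
    {ρ : ℕ → ℝ} (hkey : ∀ n, R v n ≤ ρ n * v n) (hρ1 : ∀ n, ρ n ≤ 1)
    {t : ℕ → ℝ} (htail : ∀ n, N < n → t n = 0) (hrec : ∀ n, t n = v n - R t n)
    (hSe : ∀ m, m + 1 + y ≤ j → K (m + 1) (y - 1) ≤
      (1 - σ m) * ∑ l ∈ range y, K m l * (1 - ρ (m + 1 + l)) / ∏ p ∈ Ico (m + 1 + l) (m + 1 + y), H p +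
        σ m * (K m 0 * (1 - ρ (m + 1)) / ∏ p ∈ Ico (m + 1) (m + 1 + y), H p)) :
    ∀ m, R t (m + 1) ≤ R t m := by
  have hH0 : ∀ p, 0 ≤ H p := fun p => (hH p).le
  have hsup : ∀ n, R v n ≤ v n := fun n => (hkey n).trans (by nlinarith [hρ1 n, hv0 n])
  have htv := sol_nonneg_le_of_supersol hR hK hv0 hsup htail hrec
  have ht0 := sol_support hvj htv
  have htlow := sol_lower hR hK hkey htv hrec
  intro m
  have hid := read_succ_onelag hR hKy hy hyN hσ t m
  have hlead : K m 0 * t (m + 1) ≤ R t m := by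
    rw [hR]
    have h := single_le_sum (f := fun l => K m l * t (m + 1 + l)) (fun l _ => mul_nonneg (hK m l) (htv _).1) (mem_range.mpr (by omega : 0 < N))
    simpa using h
  have hcrit : K (m + 1) (y - 1) * t (m + 1 + y) ≤ (1 - σ m) * R t m + σ m * (K m 0 * t (m + 1)) → R t (m + 1) ≤ R t m := by
    intro h
    have e1 : σ m * (R t m - K m 0 * t (m + 1)) = σ m * R t m - σ m * (K m 0 * t (m + 1)) := by ring
    have e2 : (1 - σ m) * R t m = R t m - σ m * R t m := by ring
    rw [hid]; linarith
  by_cases hedge : j < m + 1 + y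
  · refine hcrit ?_
    rw [ht0 _ hedge, mul_zero]
    have h1 : 0 ≤ (1 - σ m) * R t m := mul_nonneg (by linarith [(hσ01 m).2]) (by linarith [mul_nonneg (hK m 0) (htv (m + 1)).1])
    have h2 : 0 ≤ σ m * (K m 0 * t (m + 1)) := mul_nonneg (hσ01 m).1 (mul_nonneg (hK m 0) (htv _).1)
    linarith
  · have hmj : m + 1 + y ≤ j := by omega
    refine hcrit ?_
    -- every value inside the window against the deep end, through the growth chain read backwards
    have hback : ∀ l, l ≤ y → v (m + 1 + y) / ∏ p ∈ Ico (m + 1 + l) (m + 1 + y), H p ≤ v (m + 1 + l) := by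
      intro l hl
      have hG : 0 < ∏ p ∈ Ico (m + 1 + l) (m + 1 + y), H p := prod_pos fun p _ => hH p
      have hg := growth_chain hH0 hgrow (m + 1 + l) (y - l)
      rw [show m + 1 + l + (y - l) = m + 1 + y by omega] at hg
      rw [div_le_iff₀ hG, mul_comm]; exact hg
    have hlow : (∑ l ∈ range y, K m l * (1 - ρ (m + 1 + l)) / ∏ p ∈ Ico (m + 1 + l) (m + 1 + y), H p) * v (m + 1 + y) ≤ R t m := by
      rw [hR, sum_mul]
      have hsub : ∑ l ∈ range y, K m l * t (m + 1 + l) ≤ ∑ l ∈ range N, K m l * t (m + 1 + l) :=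
        sum_le_sum_of_subset_of_nonneg (range_subset_range.mpr hyN) fun l _ _ => mul_nonneg (hK m l) (htv _).1
      refine le_trans (sum_le_sum fun l hl => ?_) hsub
      have hly := mem_range.mp hl
      have hρl : 0 ≤ 1 - ρ (m + 1 + l) := by linarith [hρ1 (m + 1 + l)]
      have e : K m l * (1 - ρ (m + 1 + l)) / (∏ p ∈ Ico (m + 1 + l) (m + 1 + y), H p) * v (m + 1 + y) =
          K m l * ((1 - ρ (m + 1 + l)) * (v (m + 1 + y) / ∏ p ∈ Ico (m + 1 + l) (m + 1 + y), H p)) := by ring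
      rw [e]
      calc K m l * ((1 - ρ (m + 1 + l)) * (v (m + 1 + y) / ∏ p ∈ Ico (m + 1 + l) (m + 1 + y), H p))
          ≤ K m l * ((1 - ρ (m + 1 + l)) * v (m + 1 + l)) := mul_le_mul_of_nonneg_left (mul_le_mul_of_nonneg_left (hback l hly.le) hρl) (hK m l)
        _ ≤ K m l * t (m + 1 + l) := mul_le_mul_of_nonneg_left (htlow _) (hK m l)
    have hlow0 : K m 0 * (1 - ρ (m + 1)) / (∏ p ∈ Ico (m + 1) (m + 1 + y), H p) * v (m + 1 + y) ≤ K m 0 * t (m + 1) := by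
      have hρ0 : 0 ≤ 1 - ρ (m + 1) := by linarith [hρ1 (m + 1)]
      have hb := hback 0 (by omega)
      rw [Nat.add_zero] at hb
      have e : K m 0 * (1 - ρ (m + 1)) / (∏ p ∈ Ico (m + 1) (m + 1 + y), H p) * v (m + 1 + y) =
          K m 0 * ((1 - ρ (m + 1)) * (v (m + 1 + y) / ∏ p ∈ Ico (m + 1) (m + 1 + y), H p)) := by ring
      rw [e]
      calc K m 0 * ((1 - ρ (m + 1)) * (v (m + 1 + y) / ∏ p ∈ Ico (m + 1) (m + 1 + y), H p))
          ≤ K m 0 * ((1 - ρ (m + 1)) * v (m + 1)) := mul_le_mul_of_nonneg_left (mul_le_mul_of_nonneg_left hb hρ0) (hK m 0)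
        _ ≤ K m 0 * t (m + 1) := mul_le_mul_of_nonneg_left (htlow _) (hK m 0)
    have h1 : K (m + 1) (y - 1) * t (m + 1 + y) ≤ K (m + 1) (y - 1) * v (m + 1 + y) := mul_le_mul_of_nonneg_left (htv _).2 (hK _ _)
    have h4 : K (m + 1) (y - 1) * v (m + 1 + y) ≤ ((1 - σ m) * ∑ l ∈ range y, K m l * (1 - ρ (m + 1 + l)) / ∏ p ∈ Ico (m + 1 + l) (m + 1 + y), H p +
        σ m * (K m 0 * (1 - ρ (m + 1)) / ∏ p ∈ Ico (m + 1) (m + 1 + y), H p)) * v (m + 1 + y) :=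
      mul_le_mul_of_nonneg_right (hSe m hmj) (hv0 _)
    have h2 : (1 - σ m) * ((∑ l ∈ range y, K m l * (1 - ρ (m + 1 + l)) / ∏ p ∈ Ico (m + 1 + l) (m + 1 + y), H p) * v (m + 1 + y)) ≤ (1 - σ m) * R t m :=
      mul_le_mul_of_nonneg_left hlow (by linarith [(hσ01 m).2])
    have h3 : σ m * (K m 0 * (1 - ρ (m + 1)) / (∏ p ∈ Ico (m + 1) (m + 1 + y), H p) * v (m + 1 + y)) ≤ σ m * (K m 0 * t (m + 1)) :=
      mul_le_mul_of_nonneg_left hlow0 (hσ01 m).1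
    have e2 : ((1 - σ m) * ∑ l ∈ range y, K m l * (1 - ρ (m + 1 + l)) / ∏ p ∈ Ico (m + 1 + l) (m + 1 + y), H p +
        σ m * (K m 0 * (1 - ρ (m + 1)) / ∏ p ∈ Ico (m + 1) (m + 1 + y), H p)) * v (m + 1 + y) =
        (1 - σ m) * ((∑ l ∈ range y, K m l * (1 - ρ (m + 1 + l)) / ∏ p ∈ Ico (m + 1 + l) (m + 1 + y), H p) * v (m + 1 + y)) +
        σ m * (K m 0 * (1 - ρ (m + 1)) / (∏ p ∈ Ico (m + 1) (m + 1 + y), H p) * v (m + 1 + y)) := by ring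
    linarith

end Summit.QuantumFields.BalabanUV.Beta.EriceRemainderEnclosureHistoryAutonomyComparisonAgeCompositionEnteringLagLevels

end
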